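import Mathlib.AlgebraicGeometry.Morphisms.ClosedImmersion
import Mathlib.AlgebraicGeometry.PullbackCarrier
import Mathlib.Topology.Irreducible
import HarnessLib

/-!
# The base change of an open morphism with irreducible fibres along a closed immersion from an irreducible scheme is irreducible

Family `hodge`, layer `Literature/AlgebraicGeometry/Resolution`. PROOF FILE (theorems only; no
definition, no named fact). U. Görtz, T. Wedhorn, *Algebraic Geometry I* (2nd ed., 2020), Prop. 3.24
and its use on p. 574 ("as `π` is open […] and as for every `x ∈ X` the fiber `π⁻¹(x)` […] is
irreducible, `C⁰` is irreducible by Proposition 3.24"), in the following form: for `q : T ⟶ Y` with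
`q` open (e.g. smooth, or flat of finite presentation) and all fibres `q⁻¹(y)` irreducible, and a
closed immersion `ι : S ⟶ Y` from an irreducible `S`, the fibre product `T ×_Y S` is irreducible —
its first projection is a closed immersion onto `q⁻¹(ι(S))` (Mathlib `Scheme.Pullback.range_fst`),
which is irreducible by the topological lemma of `Literature/Topology/IrreducibleOfOpenMapFibres`
(restated privately here). Intended use: the cone hosts `T ×_{ℙᵈ} S` of the
cone-span leaf of Aoki's Thm. 1-4 (i) (`T` the blow-up of `ℙ^{d+1}` in the vertex with its smooth
projection `q` to `ℙᵈ`, whose fibres are projective lines: `DeJong1996.PointBlowupProjection`).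

* `IsIrreducible.preimage_range_of_isOpenMap_fibers` — `q⁻¹(ι(S))` is irreducible;
* `irreducibleSpace_pullback_of_isOpenMap_fibers` — `T ×_Y S` is irreducible.

## References

* [GortzWedhorn2020] U. Görtz, T. Wedhorn, Algebraic Geometry I: Schemes, 2nd ed., Springer 2020,
  Prop. 3.24 and p. 574.
-/

noncomputable section

open CategoryTheory CategoryTheory.Limits AlgebraicGeometry Topology

namespace Literature.AlgebraicGeometry.Resolution

universe u

variable {T Y S : Scheme.{u}}

/-- Topological core (Görtz–Wedhorn Prop. 3.24, relative form; the tree's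
`Literature.Topology.IsIrreducible.preimage_of_isOpenMap_fibers`, restated privately to keep this file's
imports minimal): preimages of irreducible sets under an open map with irreducible fibres are
irreducible. [cite: GortzWedhorn2020, Prop. 3.24] -/
private theorem isIrreducible_preimage_of_isOpenMap_fibers {X Z : Type*} [TopologicalSpace X]
    [TopologicalSpace Z] {f : X → Z} (hf : IsOpenMap f) (hfib : ∀ z, IsIrreducible (f ⁻¹' {z}))
    {A : Set Z} (hA : IsIrreducible A) : IsIrreducible (f ⁻¹' A) := by
  obtain ⟨z, hz⟩ := hA.nonempty
  obtain ⟨x, hx⟩ := (hfib z).nonempty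
  refine ⟨⟨x, by rw [Set.mem_preimage, show f x = z from hx]; exact hz⟩, ?_⟩
  rintro U V hU hV ⟨u, hu, huU⟩ ⟨v, hv, hvV⟩
  obtain ⟨y, hyA, ⟨u', hu', rfl⟩, ⟨v', hv', hv'y⟩⟩ :=
    hA.isPreirreducible (f '' U) (f '' V) (hf U hU) (hf V hV) ⟨f u, hu, u, huU, rfl⟩ ⟨f v, hv, v, hvV, rfl⟩
  obtain ⟨w, hwF, hwU, hwV⟩ :=
    (hfib (f u')).isPreirreducible U V hU hV ⟨u', rfl, hu'⟩ ⟨v', hv'y, hv'⟩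
  refine ⟨w, ?_, hwU, hwV⟩
  rw [Set.mem_preimage, show f w = f u' from hwF]
  exact hyA

/-- **`q⁻¹(ι(S))` is irreducible** for `q : T ⟶ Y` open with irreducible fibres and `ι : S ⟶ Y` any
morphism from an irreducible scheme (the image `ι(S)` is irreducible).
[cite: GortzWedhorn2020, Prop. 3.24] -/
theorem IsIrreducible.preimage_range_of_isOpenMap_fibers (q : T ⟶ Y) (ι : S ⟶ Y) [IrreducibleSpace S]
    (hqo : IsOpenMap q.base) (hfib : ∀ y : Y, IsIrreducible (q.base ⁻¹' {y})) :
    IsIrreducible (q.base ⁻¹' Set.range ι.base) := by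
  refine isIrreducible_preimage_of_isOpenMap_fibers hqo hfib ?_
  rw [← Set.image_univ]
  exact (IrreducibleSpace.isIrreducible_univ S).image _ ι.base.hom.continuous.continuousOn

/-- **`T ×_Y S` is irreducible** for `q : T ⟶ Y` open with irreducible fibres and `ι : S ⟶ Y` a
closed immersion from an irreducible scheme: `pr₁ : T ×_Y S ⟶ T` is a closed immersion (base change
of `ι`) with image `q⁻¹(ι(S))` (`Scheme.Pullback.range_fst`), a closed embedding onto an irreducible
set. [cite: GortzWedhorn2020, Prop. 3.24] -/
theorem irreducibleSpace_pullback_of_isOpenMap_fibers (q : T ⟶ Y) (ι : S ⟶ Y) [IsClosedImmersion ι]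
    [IrreducibleSpace S] (hqo : IsOpenMap q.base) (hfib : ∀ y : Y, IsIrreducible (q.base ⁻¹' {y})) :
    IrreducibleSpace ↑(pullback q ι) := by
  have hrange : Set.range (pullback.fst q ι).base = q.base ⁻¹' Set.range ι.base :=
    Scheme.Pullback.range_fst q ι
  have hirr : IsIrreducible (Set.range (pullback.fst q ι).base) := by
    rw [hrange]
    exact IsIrreducible.preimage_range_of_isOpenMap_fibers q ι hqo hfib
  have hemb : IsClosedEmbedding (pullback.fst q ι).base := (pullback.fst q ι).isClosedEmbedding
  -- transport along the homeomorphism onto the range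
  let e : ↑(pullback q ι) ≃ₜ Set.range (pullback.fst q ι).base := hemb.isEmbedding.toHomeomorph
  haveI : IrreducibleSpace (Set.range (pullback.fst q ι).base) := Subtype.irreducibleSpace hirr
  exact e.symm.surjective.irreducibleSpace e.symm.continuous

end Literature.AlgebraicGeometry.Resolution

end
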